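import Mathlib
import Summits.ValiantsHypothesis.ValiantsHypothesis.Theorems.LacunarySymmetroidThetaWitness

/-!
# `MatrixDescartes` (stmt-ValiantsHypothesis-18050) — the AMPLIFIED theta witness lands in the
# real-rooted-simple sector (lines «hyperbolic» H2 and «amplify» A2 of the crux workfiles)

HONEST FRAMING.  Helper file `--supports` the crux
`Summit.ValiantsHypothesis.ValiantsHypothesis.Theses.LacunarySymmetroid.MatrixDescartes`; it proves the
WITNESS-SIDE obligations of the two val-idea-6 lines by name-and-type (vocabulary unfolded, since line
files under `Cruxes/` are not importable here):

* `thetaWitnessPow a` = `AmplifyLine.ThetaWitnessPow a` for EVERY rate `a : ℕ` (A2, `stub_thetaWitnessPow`);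
* `hypWitnessPow a` = `AmplifyLine.HypWitnessPow a` (the sector version: the restriction is real-rooted with
  simple roots AND has `≥ 2^{a·n⌊log₂n⌋} − 1` distinct real roots);
* `hyperbolicThetaWitness` = `HyperbolicLine.HyperbolicThetaWitness` (H2, `stub_hyperbolicThetaWitness`).

Nothing here bears on the LAW side (`HyperbolicLaw`, `LinLogLaw`), on the crux, or on `VP ≠ VNP`.

## The construction (the tree's `thetaWitness_proof`, re-run ONCE with a parametric digit base)

Put `L = ⌊log₂ n⌋`, `ν = a·n·L`, `β = 2aL + 3`.  Tavenas' Cor. 3.37 (tree `Tavenas2014_cor_3_37_holds`)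
gives a multilinear `h_ν ∈ ℚ[x_0..x_{2ν+2}, z_0..z_{2ν+2}]`, a projection of `PER_{q(ν)}` with `q`
p-bounded, with `h_ν(X^{2^j}; 2^{2^i}) = V_ν = tavenasV ν`.  The tree's digit substitution
`exists_digitSubst n (2ν+3) β` (`x_j ↦ y_{⌊j/β⌋}^{2^{j mod β}}`, `z_i ↦ 2^{2^i}`; legitimate because
`2ν + 3 ≤ β n` for `n ≥ 1`) turns `h_ν ⊗ ℝ` into `Θ^{(a)}_n ∈ ℝ[y_0..y_{n-1}]`, and along the monomial
curve `y_i = X^{2^{βi}}` the restriction IS `V_ν` as a polynomial (`exists_thetaPow`).  `VNP`: verbatim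
the tree argument (`isVNPFamily_map_of_isProjection_perPoly`, `isVNPFamily_aeval_of_isPBounded`), each
substituted value now costing `≤ 2^β ≤ 8 n^{2a} + 8` gates — still p-bounded for fixed `a`.
`V_ν` has exactly `2^ν − 1` distinct real roots (tree `card_roots_toFinset_map_tavenasV`, Hutchinson) and
degree `2^ν − 1` (`natDegree_map_tavenasV`, promoted here from the crux workfile
`Cruxes/SOSTau/CensusSketch2.lean`), so it is real-rooted with simple roots.

References: S. Tavenas, PhD thesis (ENS Lyon 2014), Lemme 3.36, Cor. 3.37; P. Bürgisser, *Completeness and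
Reduction in Algebraic Complexity Theory* (2000), §2.1; J. I. Hutchinson, Trans. AMS 25 (1923).
-/

noncomputable section

-- single-conjunct layout: Sub = Summit, duplicated namespace component intended
set_option linter.dupNamespace false

namespace Summit.ValiantsHypothesis.ValiantsHypothesis.Theorems.LacunarySymmetroidMatrixDescartes.Hyperbolic

open MvPolynomial Literature.Computability.AlgebraicComplexity
open scoped Polynomial
open Summit.ValiantsHypothesis.ValiantsHypothesis.Theorems.SymmetroidDescartes (eval_map_tavenas_h)
open Summit.ValiantsHypothesis.ValiantsHypothesis.Theorems.LacunarySymmetroid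
  (isVNPFamily_aeval_of_isPBounded isVNPFamily_map_of_isProjection_perPoly exists_digitSubst)

/-! ### `V_ν` is real-rooted with simple roots -/

/-- `deg V_ν = 2^ν − 1` over `ℝ`: all `2^ν − 1` roots are real and simple, so the degree cannot be smaller;
it is `< 2^ν` by `natDegree_tavenasV_lt`.  (Promoted from the crux workfile `Cruxes/SOSTau/CensusSketch2.lean`.)
[cite: Tavenas2014, Lemme 3.36] -/
theorem natDegree_map_tavenasV (ν : ℕ) :
    ((tavenasV ν).map (Int.castRingHom ℝ)).natDegree = 2 ^ ν - 1 := by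
  apply le_antisymm
  · have h1 := natDegree_tavenasV_lt ν
    have h2 : ((tavenasV ν).map (Int.castRingHom ℝ)).natDegree ≤ (tavenasV ν).natDegree :=
      Polynomial.natDegree_map_le
    omega
  · calc 2 ^ ν - 1 = ((tavenasV ν).map (Int.castRingHom ℝ)).roots.toFinset.card :=
          (card_roots_toFinset_map_tavenasV ν).symm
      _ ≤ Multiset.card ((tavenasV ν).map (Int.castRingHom ℝ)).roots := Multiset.toFinset_card_le _
      _ ≤ _ := Polynomial.card_roots' _

/-- `V_ν` lies in the real-rooted-simple sector: it has `natDegree`-many distinct real roots.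
[cite: Tavenas2014, Lemme 3.36] -/
theorem card_roots_toFinset_eq_natDegree_map_tavenasV (ν : ℕ) :
    ((tavenasV ν).map (Int.castRingHom ℝ)).roots.toFinset.card =
      ((tavenasV ν).map (Int.castRingHom ℝ)).natDegree := by
  rw [card_roots_toFinset_map_tavenasV, natDegree_map_tavenasV]

/-! ### The amplified witness: `Θ^{(a)}_n(X^{2^{βi}}) = V_{a n ⌊log₂ n⌋}` -/

/-- **The amplified theta family at rate `a`.**  There are a real family `Θ_n ∈ ℝ[y_0, …, y_{n-1}]` with
`VNP` complexification and exponents `d_{n,i}` such that for every `n ≥ 1` the restriction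
`Θ_n(X^{d_{n,0}}, …, X^{d_{n,n-1}})` EQUALS `V_{a·n·⌊log₂ n⌋}` as a real polynomial.  Witness:
`Θ_n = h_ν ⊗ ℝ` (`ν = a n ⌊log₂ n⌋`, Tavenas Cor. 3.37) under the digit substitution with base exponent
`β = 2a⌊log₂ n⌋ + 3`, and `d_{n,i} = 2^{β i}`. -/
theorem exists_thetaPow (a : ℕ) :
    ∃ (Θ : ∀ n : ℕ, MvPolynomial (Fin n) ℝ) (d : ∀ n : ℕ, Fin n → ℕ),
      IsVNPFamily (fun n => MvPolynomial.map (algebraMap ℝ ℂ) (Θ n)) ∧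
      ∀ n : ℕ, 1 ≤ n →
        MvPolynomial.aeval (fun i => (Polynomial.X : ℝ[X]) ^ d n i) (Θ n) =
          (tavenasV (a * (n * Nat.log 2 n))).map (Int.castRingHom ℝ) := by
  obtain ⟨q, hq, hh⟩ := Tavenas2014_cor_3_37_holds
  choose h hproj _ hsub using hh
  choose g hgcx hgdeg hgev using fun n : ℕ =>
    exists_digitSubst n (2 * (a * (n * Nat.log 2 n)) + 3) (2 * (a * Nat.log 2 n) + 3) (Nat.succ_pos _)
  refine ⟨fun n => aeval (g n) (MvPolynomial.map (algebraMap ℚ ℝ) (h (a * (n * Nat.log 2 n)))),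
    fun n i => 2 ^ ((2 * (a * Nat.log 2 n) + 3) * (i : ℕ)), ?_, fun n hn => ?_⟩
  · /- VNP: the complexification is the substituted family over `ℂ` -/
    have hβ : ∀ n : ℕ, 2 ^ (2 * (a * Nat.log 2 n) + 3) ≤ 8 * n ^ (2 * a) + 8 := by
      intro n
      rcases Nat.eq_zero_or_pos n with rfl | hn
      · simp
      · have h1 : 2 ^ Nat.log 2 n ≤ n := Nat.pow_log_le_self 2 hn.ne'
        have h2 : (2 ^ Nat.log 2 n) ^ (2 * a) ≤ n ^ (2 * a) := Nat.pow_le_pow_left h1 _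
        have e : 2 ^ (2 * (a * Nat.log 2 n) + 3) = 8 * (2 ^ Nat.log 2 n) ^ (2 * a) := by
          rw [pow_add, ← pow_mul]
          ring_nf
        rw [e]
        omega
    have hmap : ∀ n : ℕ, MvPolynomial.map (algebraMap ℝ ℂ)
        (aeval (g n) (MvPolynomial.map (algebraMap ℚ ℝ) (h (a * (n * Nat.log 2 n))))) =
        aeval (fun v => MvPolynomial.map (algebraMap ℝ ℂ) (g n v))
          (MvPolynomial.map (algebraMap ℚ ℂ) (h (a * (n * Nat.log 2 n)))) := by
      intro n
      rw [aeval_eq_bind₁, aeval_eq_bind₁, map_bind₁, map_map]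
      congr 2
    simp only [hmap]
    have hlog : IsPBounded (Nat.log 2) := IsPBounded.id.mono fun n => Nat.log_le_self 2 n
    have hν : IsPBounded fun n => a * (n * Nat.log 2 n) :=
      IsPBounded.mul_holds (IsPBounded.const a) (IsPBounded.mul_holds IsPBounded.id hlog)
    have hpow : IsPBounded fun n => n ^ (2 * a) := ⟨2 * a, fun n => Nat.le_add_right _ _⟩
    have hB : IsPBounded fun n =>
        (n + 2 * (2 * (a * (n * Nat.log 2 n)) + 3)) * (8 * n ^ (2 * a) + 8) :=
      IsPBounded.mul_holds
        (IsPBounded.add_holds IsPBounded.id (IsPBounded.mul_holds (IsPBounded.const 2)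
          (IsPBounded.add_holds (IsPBounded.mul_holds (IsPBounded.const 2) hν) (IsPBounded.const 3))))
        (IsPBounded.add_holds (IsPBounded.mul_holds (IsPBounded.const 8) hpow) (IsPBounded.const 8))
    refine isVNPFamily_aeval_of_isPBounded
      (σ := fun n => Fin (2 * (a * (n * Nat.log 2 n)) + 3) ⊕ Fin (2 * (a * (n * Nat.log 2 n)) + 3))
      (τ := fun n => Fin n)
      (isVNPFamily_map_of_isProjection_perPoly (σ := fun n =>
          Fin (2 * (a * (n * Nat.log 2 n)) + 3) ⊕ Fin (2 * (a * (n * Nat.log 2 n)) + 3))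
        (q := fun n => q (a * (n * Nat.log 2 n))) (IsPBounded.comp_holds hq hν) ?_
        (fun n => h (a * (n * Nat.log 2 n))) fun n => hproj (a * (n * Nat.log 2 n)))
      (fun n v => MvPolynomial.map (algebraMap ℝ ℂ) (g n v)) hB
      (fun n => ?_) (fun n => ?_) (fun n v => ?_)
    · -- number of variables of `h_ν`
      refine (IsPBounded.add_holds (IsPBounded.add_holds (IsPBounded.mul_holds (IsPBounded.const 2) hν)
        (IsPBounded.const 3)) (IsPBounded.add_holds (IsPBounded.mul_holds (IsPBounded.const 2) hν)
        (IsPBounded.const 3))).mono fun n => ?_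
      rw [Fintype.card_sum, Fintype.card_fin]
    · -- number of variables of `Θ_n`
      rw [Fintype.card_fin]
      have : 1 ≤ 8 * n ^ (2 * a) + 8 := by omega
      calc n ≤ n + 2 * (2 * (a * (n * Nat.log 2 n)) + 3) := Nat.le_add_right _ _
        _ = (n + 2 * (2 * (a * (n * Nat.log 2 n)) + 3)) * 1 := (mul_one _).symm
        _ ≤ _ := Nat.mul_le_mul_left _ this
    · -- total cost of the substitution
      calc ∑ v, complexity (MvPolynomial.map (algebraMap ℝ ℂ) (g n v))
          ≤ ∑ _v : Fin (2 * (a * (n * Nat.log 2 n)) + 3) ⊕ Fin (2 * (a * (n * Nat.log 2 n)) + 3),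
              2 ^ (2 * (a * Nat.log 2 n) + 3) := Finset.sum_le_sum fun v _ => hgcx n v
        _ = (2 * (2 * (a * (n * Nat.log 2 n)) + 3)) * 2 ^ (2 * (a * Nat.log 2 n) + 3) := by
          rw [Finset.sum_const, Finset.card_univ, Fintype.card_sum, Fintype.card_fin, smul_eq_mul]
          ring
        _ ≤ (n + 2 * (2 * (a * (n * Nat.log 2 n)) + 3)) * (8 * n ^ (2 * a) + 8) :=
          Nat.mul_le_mul (Nat.le_add_left _ _) (hβ n)
    · -- degrees of the substituted values
      calc (MvPolynomial.map (algebraMap ℝ ℂ) (g n v)).totalDegree ≤ 2 ^ (2 * (a * Nat.log 2 n) + 3) :=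
            hgdeg n v
        _ ≤ 8 * n ^ (2 * a) + 8 := hβ n
        _ = 1 * (8 * n ^ (2 * a) + 8) := (one_mul _).symm
        _ ≤ (n + 2 * (2 * (a * (n * Nat.log 2 n)) + 3)) * (8 * n ^ (2 * a) + 8) :=
          Nat.mul_le_mul_right _ (by omega)
  · /- the restriction along `y_i = X^{2^{β i}}` is `V_ν`, `ν = a n ⌊log₂ n⌋` -/
    have hm : 2 * (a * (n * Nat.log 2 n)) + 3 ≤ (2 * (a * Nat.log 2 n) + 3) * n := by nlinarith
    apply Polynomial.funext
    intro x
    rw [← eval_map_tavenas_h (hsub (a * (n * Nat.log 2 n))) x, ← Polynomial.coe_aeval_eq_eval,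
      comp_aeval_apply, comp_aeval_apply, MvPolynomial.aeval_eq_eval]
    have hF : (fun v => aeval (fun i : Fin n => Polynomial.aeval x
          ((Polynomial.X : Polynomial ℝ) ^ 2 ^ ((2 * (a * Nat.log 2 n) + 3) * (i : ℕ)))) (g n v)) =
        Sum.elim (fun j : Fin (2 * (a * (n * Nat.log 2 n)) + 3) => x ^ 2 ^ (j : ℕ))
          (fun i : Fin (2 * (a * (n * Nat.log 2 n)) + 3) => (2 : ℝ) ^ 2 ^ (i : ℕ)) := by
      funext v
      rw [← hgev n hm x v, MvPolynomial.aeval_eq_eval]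
      have hpt : (fun i : Fin n => Polynomial.aeval x
          ((Polynomial.X : Polynomial ℝ) ^ 2 ^ ((2 * (a * Nat.log 2 n) + 3) * (i : ℕ)))) =
          fun i : Fin n => x ^ 2 ^ ((2 * (a * Nat.log 2 n) + 3) * (i : ℕ)) := by
        funext i
        simp only [map_pow, Polynomial.aeval_X]
      rw [hpt]
    rw [hF]

/-! ### The sector witnesses, by name and type -/

/-- **`HypWitnessPow a` (line «amplify», sector version of A2) — unfolded**: for every rate `a` there is a real
family with `VNP` complexification whose lacunary restriction is, for all `n ≥ 1`, real-rooted with simple roots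
(`#distinct real roots = natDegree`) and has `≥ 2^{a·n⌊log₂n⌋} − 1` distinct real roots. -/
theorem hypWitnessPow (a : ℕ) :
    ∃ (Θ : ∀ n : ℕ, MvPolynomial (Fin n) ℝ) (d : ∀ n : ℕ, Fin n → ℕ),
      IsVNPFamily (fun n => MvPolynomial.map (algebraMap ℝ ℂ) (Θ n)) ∧
        ∃ n₀ : ℕ, ∀ n : ℕ, n₀ ≤ n →
          (MvPolynomial.aeval (fun i => (Polynomial.X : ℝ[X]) ^ d n i) (Θ n)).roots.toFinset.card =
              (MvPolynomial.aeval (fun i => (Polynomial.X : ℝ[X]) ^ d n i) (Θ n)).natDegree ∧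
          2 ^ (a * (n * Nat.log 2 n)) ≤
            (MvPolynomial.aeval (fun i => (Polynomial.X : ℝ[X]) ^ d n i) (Θ n)).roots.toFinset.card + 1 := by
  obtain ⟨Θ, d, hV, hres⟩ := exists_thetaPow a
  refine ⟨Θ, d, hV, 1, fun n hn => ?_⟩
  rw [hres n hn, card_roots_toFinset_eq_natDegree_map_tavenasV, natDegree_map_tavenasV]
  have h1 : 1 ≤ 2 ^ (a * (n * Nat.log 2 n)) := Nat.one_le_two_pow
  exact ⟨rfl, by omega⟩

/-- **`ThetaWitnessPow a` (line «amplify», obligation A2 `stub_thetaWitnessPow`) — unfolded, for EVERY `a`**: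
a real family with `VNP` complexification whose lacunary restriction eventually has `≥ 2^{a·n⌊log₂n⌋} − 1`
distinct real roots. -/
theorem thetaWitnessPow (a : ℕ) :
    ∃ (Θ : ∀ n : ℕ, MvPolynomial (Fin n) ℝ) (d : ∀ n : ℕ, Fin n → ℕ),
      IsVNPFamily (fun n => MvPolynomial.map (algebraMap ℝ ℂ) (Θ n)) ∧
        ∃ n₀ : ℕ, ∀ n : ℕ, n₀ ≤ n →
          2 ^ (a * (n * Nat.log 2 n)) ≤
            (MvPolynomial.aeval (fun i => (Polynomial.X : ℝ[X]) ^ d n i) (Θ n)).roots.toFinset.card + 1 := by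
  obtain ⟨Θ, d, hV, n₀, hw⟩ := hypWitnessPow a
  exact ⟨Θ, d, hV, n₀, fun n hn => (hw n hn).2⟩

/-- The same witnesses in DEGREE currency: the restriction is real-rooted with simple roots and has
`natDegree ≥ 2^{a·n⌊log₂n⌋} − 1`. -/
theorem hypWitnessPow_natDegree (a : ℕ) :
    ∃ (Θ : ∀ n : ℕ, MvPolynomial (Fin n) ℝ) (d : ∀ n : ℕ, Fin n → ℕ),
      IsVNPFamily (fun n => MvPolynomial.map (algebraMap ℝ ℂ) (Θ n)) ∧
        ∃ n₀ : ℕ, ∀ n : ℕ, n₀ ≤ n →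
          (MvPolynomial.aeval (fun i => (Polynomial.X : ℝ[X]) ^ d n i) (Θ n)).roots.toFinset.card =
              (MvPolynomial.aeval (fun i => (Polynomial.X : ℝ[X]) ^ d n i) (Θ n)).natDegree ∧
          2 ^ (a * (n * Nat.log 2 n)) ≤
            (MvPolynomial.aeval (fun i => (Polynomial.X : ℝ[X]) ^ d n i) (Θ n)).natDegree + 1 := by
  obtain ⟨Θ, d, hV, n₀, hw⟩ := hypWitnessPow a
  refine ⟨Θ, d, hV, n₀, fun n hn => ⟨(hw n hn).1, ?_⟩⟩
  rw [← (hw n hn).1]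
  exact (hw n hn).2

/-- **`HyperbolicThetaWitness` (line «hyperbolic», obligation H2 `stub_hyperbolicThetaWitness`) — unfolded**:
a real family with `VNP` complexification and exponents such that eventually the lacunary restriction is
real-rooted with simple roots (`#distinct real roots = natDegree`, i.e. the line's `IsRealRootedSimple`) and
has `natDegree + 1 ≥ 2^{n⌊log₂n⌋}`.  The rate-`1` instance of `hypWitnessPow_natDegree`. -/
theorem hyperbolicThetaWitness :
    ∃ (Θ : ∀ n : ℕ, MvPolynomial (Fin n) ℝ) (d : ∀ n : ℕ, Fin n → ℕ),
      IsVNPFamily (fun n => MvPolynomial.map (algebraMap ℝ ℂ) (Θ n)) ∧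
      ∃ n₀ : ℕ, ∀ n : ℕ, n₀ ≤ n →
        (MvPolynomial.aeval (fun i => (Polynomial.X : ℝ[X]) ^ d n i) (Θ n)).roots.toFinset.card =
            (MvPolynomial.aeval (fun i => (Polynomial.X : ℝ[X]) ^ d n i) (Θ n)).natDegree ∧
        2 ^ (n * Nat.log 2 n) ≤
          (MvPolynomial.aeval (fun i => (Polynomial.X : ℝ[X]) ^ d n i) (Θ n)).natDegree + 1 := by
  obtain ⟨Θ, d, hV, n₀, hw⟩ := hypWitnessPow_natDegree 1
  refine ⟨Θ, d, hV, n₀, fun n hn => ⟨(hw n hn).1, ?_⟩⟩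
  have h := (hw n hn).2
  rwa [one_mul] at h

end Summit.ValiantsHypothesis.ValiantsHypothesis.Theorems.LacunarySymmetroidMatrixDescartes.Hyperbolic

end
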